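import Mathlib
import Literature.RingTheory.Multisymmetric.LowDegreeFreeness
import Literature.Computability.AlgebraicComplexity.OrbitClosureWeights
import Literature.Computability.AlgebraicComplexity.PlethysmLifting
import Literature.Computability.AlgebraicComplexity.MultiplicityObstructionsProofs
import Summits.ValiantsHypothesis.ValiantsHypothesis.Theorems.ValuativeGCTValuativeFlipDetDiagonalPencil

/-!
# Torus weight vectors of small body do not vanish on `End · det_m`

Wall-breaker axis D (det-orbit-closure multiplicity bounds) for crux `ValuativeGCT.ValuativeFlip`
(stmt-ValiantsHypothesis-12624): the heart of the det-side theorem "no equations of `Det_m` of small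
body" (`NoSmallBodyEquations`: `K_m(λ*) = a_λ(δ[m])` whenever `|λ̄| = mδ - λ₁ ≤ m`).

Let `F ≠ 0` be a torus weight vector of weight `χ` in `k[Sym^m k^{m×m}]` (`coordRep (MatIdx m) k m`),
of degree `D` (`|χ| = -mD`), and let `i₀` be a letter with BODY `mD + χ i₀ ≤ m` (for `χ = λ*` and `i₀`
the top letter this is `|λ̄| ≤ m`).  Every monomial `∏ X_{d}^{s d}` of `F` has torus weight `χ`
(`monWeight_eq_of_mem_weightSpace`), hence `∑_d s(d) (m - d i₀) = mD + χ i₀ ≤ m`: renaming the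
coordinate `X_d` to the symbol `Z_{d|_{i ≠ i₀}}` turns `F` into a nonzero polynomial `Q` in the `Z_α`,
homogeneous of degree `D`, of weighted degree `≤ m`.  At the DIAGONAL PENCIL
`A · det_m = ∏_a (x_{i₀} + ∑_{i ≠ i₀} X(i,a) x_i)` (file `…DetDiagonalPencil`) the coordinates `X_d` become
the elementary multisymmetric polynomials `e_{d|_{i ≠ i₀}}(t_1, …, t_m)`, so `F(A · det_m) = Q(e) ≠ 0` by
the low-degree freeness of the `e_α` (`Literature/RingTheory/Multisymmetric/LowDegreeFreeness.lean`).
Specialising the point variables gives a matrix `A₀ ∈ End(k^{m×m})` with `F(A₀ · det_m) ≠ 0`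
(`exists_aeval_formCoeff_linSubst_detFormLex_ne_zero`), hence `F ∉ I(GL · det_m)`
(`not_mem_orbitVanishingIdeal_detFormLex_of_body_le`, via the generic orbit map).

All statements over a field `k` of characteristic zero; no new definitions. [folklore method:
evaluation of highest-weight vectors at explicit points, BLMW 2011 §5; the pencil/multisymmetric
identification is new here]
-/

set_option linter.dupNamespace false

namespace Summit.ValiantsHypothesis.ValiantsHypothesis.Theorems.ValuativeFlip

open MvPolynomial
open scoped BigOperators Matrix
open Literature.NumberTheory.DiophantineGeometry
open Literature.Computability.AlgebraicComplexity
open Literature.RingTheory.Multisymmetric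

noncomputable section

/-- Evaluating, at a point `x` of the parameter space, the pull-back of `F` along a pencil
`A` with polynomial entries gives `F` at the point `A(x) · f` of the endomorphism orbit. [folklore] -/
theorem aeval_aeval_coeff_linSubst_map {k : Type*} [Field k] {σ τ : Type*} [Fintype σ] [DecidableEq σ] (m : ℕ)
    (f : MvPolynomial σ k) (A : Matrix σ σ (MvPolynomial τ k)) (x : τ → k)
    (F : MvPolynomial (DegIdx σ m) k) :
    aeval x (aeval (fun d : DegIdx σ m =>
        coeff d.1 (linSubst σ (MvPolynomial τ k) A (map (C : k →+* MvPolynomial τ k) f))) F) =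
      aeval (formCoeff m (linSubst σ k (A.map (eval x)) f)) F := by
  rw [← AlgHom.comp_apply, comp_aeval]
  have hfun : (fun d : DegIdx σ m => aeval x
      (coeff d.1 (linSubst σ (MvPolynomial τ k) A (map (C : k →+* MvPolynomial τ k) f)))) =
      formCoeff m (linSubst σ k (A.map (eval x)) f) := by
    funext d
    rw [formCoeff_apply]
    change eval x (coeff d.1 _) = _
    rw [← coeff_map, map_linSubst, map_map]
    have : (eval x).comp (C : k →+* MvPolynomial τ k) = RingHom.id k := RingHom.ext fun c => eval_C c
    rw [this, map_id]
  rw [hfun]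

/-- Over an infinite field a nonzero polynomial has a non-root. [folklore] -/
theorem exists_eval_ne_zero_of_ne_zero {k : Type*} [Field k] [Infinite k] {τ : Type*} {P : MvPolynomial τ k} (hP : P ≠ 0) :
    ∃ x : τ → k, eval x P ≠ 0 := by
  by_contra h
  push Not at h
  exact hP (MvPolynomial.funext fun x => by rw [h x, map_zero])

/-- **A torus weight vector of small body does not vanish at some `End`-point of `det_m`.**  Let
`F ≠ 0` lie in the weight space of weight `χ` of `k[Sym^m k^{m×m}]`, `|χ| = -mD`, and let the body at
the letter `i₀` satisfy `mD + χ i₀ ≤ m`.  Then `F(A · det_m) ≠ 0` for some matrix `A` (the diagonal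
pencil of `det_m` at a suitable parameter value).  Registered sub-goal of the crux (wall-breaker k7,
axis D). [folklore method; new identification] -/
theorem exists_aeval_formCoeff_linSubst_detFormLex_ne_zero {k : Type*} [Field k] [CharZero k] {m : ℕ} (i₀ : MatIdx m) {χ : Weight (MatIdx m)} {F : MvPolynomial (DegIdx (MatIdx m) m) k} (hF : F ∈ weightSpace (coordRep (MatIdx m) k m) χ) (hF0 : F ≠ 0) {D : ℕ} (hD : χ.size = -((m * D : ℕ) : ℤ)) (hbody : ((m * D : ℕ) : ℤ) + χ i₀ ≤ m) : ∃ A : Matrix (MatIdx m) (MatIdx m) k, aeval (formCoeff m (linSubst (MatIdx m) k A (detFormLex k m))) F ≠ 0 := by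
  classical
  -- the letters off the base letter, the parameter ring, the pencil, the body map
  set R : Type _ := MvPolynomial ({i : MatIdx m // i ≠ i₀} × Fin m) k with hR
  set A : Matrix (MatIdx m) (MatIdx m) (MvPolynomial ({i : MatIdx m // i ≠ i₀} × Fin m) k) :=
    fun (l j : MatIdx m) => if (ofLex j).1 = (ofLex j).2 then
      (if h : l = i₀ then (1 : MvPolynomial ({i : MatIdx m // i ≠ i₀} × Fin m) k)
        else X (⟨l, h⟩, (ofLex j).1)) else 0 with hA
  set γ : DegIdx (MatIdx m) m → ({i : MatIdx m // i ≠ i₀} →₀ ℕ) :=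
    fun d => d.1.subtypeDomain (fun i => i ≠ i₀) with hγ
  have hm : 0 < m := Fin.pos (ofLex i₀).1
  have hdegd : ∀ d : DegIdx (MatIdx m) m, d.1.degree = m := fun d => mem_degMonomials_iff.mp d.2
  have hle : ∀ d : DegIdx (MatIdx m) m, d.1 i₀ ≤ m := fun d => by
    have h1 := degree_eq_degree_subtypeDomain_add i₀ d.1
    have h2 := hdegd d
    omega
  have hγdeg : ∀ d : DegIdx (MatIdx m) m, (γ d).degree = m - d.1 i₀ := fun d => by
    have h1 := degree_eq_degree_subtypeDomain_add i₀ d.1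
    have h2 := hdegd d
    show (d.1.subtypeDomain fun i => i ≠ i₀).degree = m - d.1 i₀
    omega
  -- torus weights and degrees of the monomials of `F`
  have hw : ∀ s ∈ F.support, monWeight s = χ := fun s hs => monWeight_eq_of_mem_weightSpace hF hs
  have hdegs : ∀ s ∈ F.support, s.degree = D := by
    intro s hs
    have h1 := size_monWeight (σ := MatIdx m) s
    rw [hw s hs, hD, neg_inj, Nat.cast_inj] at h1
    exact (Nat.eq_of_mul_eq_mul_left hm h1).symm
  -- the body bound for each monomial
  have hbodys : ∀ s ∈ F.support, (vpContent (s.mapDomain γ)).degree ≤ m := by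
    intro s hs
    have hc : vpContent (s.mapDomain γ) = s.sum (fun d e => e • γ d) := by
      unfold vpContent
      exact Finsupp.sum_mapDomain_index (fun _ => zero_smul _ _) (fun _ _ _ => add_smul _ _ _)
    rw [hc, Finsupp.sum, map_sum]
    simp only [map_nsmul, smul_eq_mul, hγdeg]
    have key : ((∑ d ∈ s.support, s d * (m - d.1 i₀) : ℕ) : ℤ) = ((m * D : ℕ) : ℤ) + χ i₀ := by
      rw [← hw s hs, monWeight_apply, ← hdegs s hs, Finsupp.degree_apply, Finset.mul_sum,
        Nat.cast_sum, Nat.cast_sum, Nat.cast_sum, ← sub_eq_add_neg, ← Finset.sum_sub_distrib]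
      refine Finset.sum_congr rfl fun d _ => ?_
      rw [Nat.cast_mul, Nat.cast_sub (hle d), Nat.cast_mul, Nat.cast_mul]
      ring
    have h := hbody
    rw [← key] at h
    exact_mod_cast h
  -- the renamed polynomial `Q = F(Z_{γ d})`
  have hγinj : Function.Injective γ := by
    intro d₁ d₂ h
    apply Subtype.ext
    exact eq_of_subtypeDomain_eq_of_degree_eq i₀ h (by rw [hdegd d₁, hdegd d₂])
  have hQ0 : rename γ F ≠ 0 := fun h =>
    hF0 (rename_injective γ hγinj (by rw [h, map_zero]))
  have hsuppQ : ∀ s' ∈ (rename γ F).support, ∃ s ∈ F.support, s' = Finsupp.mapDomain γ s := by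
    intro s' hs'
    rw [support_rename_of_injective hγinj] at hs'
    obtain ⟨s, hs, rfl⟩ := Finset.mem_image.mp hs'
    exact ⟨s, hs, rfl⟩
  have hne : aeval (elemMultisymm (k := k) {i : MatIdx m // i ≠ i₀} m) (rename γ F) ≠ 0 := by
    refine aeval_elemMultisymm_ne_zero_of_degree_eq (D := D) (fun s' hs' => ?_) (fun s' hs' => ?_) hQ0
    · obtain ⟨s, hs, rfl⟩ := hsuppQ s' hs'
      rw [Finsupp.degree_mapDomain]
      exact hdegs s hs
    · obtain ⟨s, hs, rfl⟩ := hsuppQ s' hs'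
      exact hbodys s hs
  -- at the diagonal pencil the coordinates are the elementary multisymmetric polynomials
  have hΨ : aeval (elemMultisymm (k := k) {i : MatIdx m // i ≠ i₀} m) (rename γ F) =
      aeval (fun d : DegIdx (MatIdx m) m => coeff d.1 (linSubst (MatIdx m) R A
        (map (C : k →+* R) (detFormLex k m)))) F := by
    have hfun : (elemMultisymm (k := k) {i : MatIdx m // i ≠ i₀} m) ∘ γ =
        fun d : DegIdx (MatIdx m) m => coeff d.1 (linSubst (MatIdx m) R A
          (map (C : k →+* R) (detFormLex k m))) :=
      funext fun d => (coeff_linSubst_diagPencil_detFormLex i₀ d.1 (hdegd d)).symm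
    rw [aeval_rename, hfun]
  rw [hΨ] at hne
  -- specialise the parameters
  obtain ⟨x, hx⟩ := exists_eval_ne_zero_of_ne_zero hne
  refine ⟨A.map (eval x), ?_⟩
  rw [← aeval_aeval_coeff_linSubst_map]
  exact hx

/-- **Small-body weight vectors are not equations of `Det_m`.**  Under the hypotheses of
`exists_aeval_formCoeff_linSubst_detFormLex_ne_zero`, `F ∉ I(GL · det_m)`: the generic orbit map of
`F` does not vanish at the matrix found there (`eval_genericOrbitMap`,
`orbitVanishingIdeal_eq_ker_genericOrbitMap`). [folklore method; new identification] -/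
theorem not_mem_orbitVanishingIdeal_detFormLex_of_body_le {k : Type*} [Field k] [CharZero k] {m : ℕ} (i₀ : MatIdx m)
    {χ : Weight (MatIdx m)} {F : MvPolynomial (DegIdx (MatIdx m) m) k}
    (hF : F ∈ weightSpace (coordRep (MatIdx m) k m) χ) {D : ℕ}
    (hD : χ.size = -((m * D : ℕ) : ℤ)) (hbody : ((m * D : ℕ) : ℤ) + χ i₀ ≤ m) (hF0 : F ≠ 0) :
    F ∉ orbitVanishingIdeal (detFormLex k m) m := by
  intro hI
  obtain ⟨A, hA⟩ := exists_aeval_formCoeff_linSubst_detFormLex_ne_zero i₀ hF hF0 hD hbody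
  apply hA
  rw [← eval_genericOrbitMap]
  have h0 : genericOrbitMap (detFormLex k m) m F = 0 := by
    rw [orbitVanishingIdeal_eq_ker_genericOrbitMap] at hI
    exact RingHom.mem_ker.mp hI
  rw [h0, map_zero]

end

end Summit.ValiantsHypothesis.ValiantsHypothesis.Theorems.ValuativeFlip
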